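import Summits.QuantumFields.YangMills.Theorems.VirialFluxGapFrameKernelOfFlat
import Summits.QuantumFields.YangMills.Theorems.VirialFluxGapValleyCombFamily
import Summits.QuantumFields.YangMills.Theorems.VirialFluxGapRegularValleyAxis
import Summits.QuantumFields.YangMills.Theorems.VirialFluxGapRadialProfile
import Summits.QuantumFields.YangMills.Theorems.LuscherReductionRunningReductionAxialGauge
import HarnessLib

/-!
# Route `VirialFluxGap` (YangMills): the FOUR SHEET TANGENTS at a flat comb ring are EXACT KERNEL VECTORS of the frame Hessian

Assignment (K) of the ⟨stmt-QuantumFields-24141⟩ `PeriodicSoftness` team, concrete half (LEAD ruling 2026-08-30T23:30Z: host `X_fix`, `m = 4`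
exact kernel vectors at the Taylor base point = the flat comb ring of ✓`exists_zero_near_of_regular` with data on one axis by
✓`exists_commuting_near_of_far_axis`).  Built on ✓∕⧗`VirialFluxGapFrameKernelOfFlat` (flat curve directions are kernel vectors, any frame
family `τ`) and ✓`VirialFluxGapValleyCombFamily` (the comb family is flat):

* §2 the BLOCK directions `wrapBlockDir k Y₀` (the matrix `Y₀` on every wrap link `x_k = −1` of direction `k` of EVERY slice, `0` elsewhere)
  and `seamBlockDir Y₀` (`Y₀` on every seam site); their multi-direction curves through the comb point `((fun _ => combFlat h'), fun _ => c')`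
  are the comb rings with data `h' k ↦ h' k·exp(sY₀)` resp. `c' ↦ c'·exp(sY₀)` (`comb_mul_wrapBlock` ∕ `comb_mul_seamBlock`, `combRing_one`),
  hence FLAT for all `s` once `exp(sY₀)` centralises the commuting data (★ `ringDeficit_comb_mul_multiCurve_wrapBlockDir_eq_zero` ∕
  `…seamBlockDir_eq_zero`, from ✓`ringDeficit_combRing_update_eq_zero` ∕ ✓`…seam_mul_eq_zero` at `t = 1`);
* §3 on an AXIS `n = (n₁,n₂,n₃)`: `exp(s·quatMatrix⟨0,n⟩)` commutes with every `y ∈ SU(2)` whose quaternion has imaginary part `∥ n`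
  (`expSU_quatMatrix_comm_of_im_parallel`, via ✓`mul_comm_of_im_parallel'` and `Commute.exp_left`), so for comb data on the axis the
  four sheet curves are flat: ★★ `ringDeficit_comb_wrapSheet_eq_zero` (k = 0,1,2), ★★ `ringDeficit_comb_seamSheet_eq_zero`;
* §4 ★★★ `frameHessRaw_mulVec_eq_zero_of_dirOf_eq_wrapBlockDir` ∕ `…_seamBlockDir` — for EVERY skew-Hermitian traceless frame family `τ`
  and every coordinate vector `κ` with `dirOf τ κ =` the block direction of `quatMatrix⟨0,n⟩`: `Ĥ(p)κ = 0` at the comb ring `p` — the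
  `hBk` input of ✓`approxKernel_of_kernel` (normalise `κ` and take the four disjointly supported ones for ✓`trace_resolvent_le`);
* §5 the same base point on `X_fix`: `glue_off_combFlat` (glue of the off-tree part of `combFlat h'` is `combFlat h'`) and `fixEmbed_fixComb`
  (the tree-gauge embedding `x ↦ (glue x.1 ∷ x.2.1, x.2.2)` of ✓`TreeGaugeTransfer.gibbsMean_eq_fix` sends the `X_fix` comb point to `p`).

HONEST FRAMING: helper algebra for the generic chart; the coordinates `κ` in the host's concrete `τ` (one basis matrix at one variable), the
polynomial constants, the cut-offs and the central charts are NOT here; ⟨24141⟩ and ⟨22884⟩ stay OPEN; no stub ∕ crux ∕ rung ∕ summit is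
closed; the Yang–Mills mass gap is NOT proved; no summit is proved by a line.  Two problem-side data definitions (`wrapBlockDir`,
`seamBlockDir`; no `Prop`), 0 `sorry`, standard axioms.  Width seat `ym-line-sfw-p2-w2` g51 (cell ym-idea-1, free hands),
`--supports stmt-QuantumFields-24141`.  References: [cite: Luscher1983, §2] (toron valley), [folklore].
-/

set_option autoImplicit false

noncomputable section

open scoped Matrix BigOperators ContDiff Topology Quaternion
open MeasureTheory Set Matrix
open Literature.MathematicalPhysics.QuantumFieldTheory hiding SU2
open Literature.MathematicalPhysics.QuantumLattice
open Literature.MathematicalPhysics.QuantumFieldTheory.SUNBakryEmery (expSU coe_expSU matTop)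

namespace Summit.QuantumFields.YangMills.Theorems.VirialFluxGap.RegularValley

open Summit.QuantumFields.YangMills.Theorems.FemtoTransferGap
open Summit.QuantumFields.YangMills.Theorems.FemtoTransferGap.TT
open Summit.QuantumFields.YangMills.Theorems.FemtoTransferGap.TwoLattice
open Summit.QuantumFields.YangMills.Theorems.FemtoTransferGap.TwoLattice.Flat
open Summit.QuantumFields.YangMills.Theorems.VirialFluxGap.RingDeficit
open Summit.QuantumFields.YangMills.Theorems.VirialFluxGap.FrameDerivative
open Summit.QuantumFields.YangMills.Theorems.VirialFluxGap.FrameHessian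

variable {L : ℕ} [NeZero L]
variable {ι : Type*}

/-! ## §2 Block directions and their curves through a comb point -/

omit [NeZero L] in
/-- The WRAP-BLOCK direction: the matrix `Y₀` on every wrap link (`x_k = −1`) of direction `k` in every slice, `0` elsewhere. [folklore] -/
def wrapBlockDir (k : Fin 3) (Y₀ : Matrix (Fin 2) (Fin 2) ℂ) : ((Fin (2 * L - 1 + 1) × Edge 3 L) ⊕ Site 3 L) → Matrix (Fin 2) (Fin 2) ℂ :=
  Sum.elim (fun ie => if ie.2.1 ie.2.2 = -1 ∧ ie.2.2 = k then Y₀ else 0) (fun _ => 0)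

omit [NeZero L] in
/-- The SEAM-BLOCK direction: the matrix `Y₀` on every seam site, `0` on every slice link. [folklore] -/
def seamBlockDir (Y₀ : Matrix (Fin 2) (Fin 2) ℂ) : ((Fin (2 * L - 1 + 1) × Edge 3 L) ⊕ Site 3 L) → Matrix (Fin 2) (Fin 2) ℂ :=
  Sum.elim (fun _ => 0) (fun _ => Y₀)

omit [NeZero L] in
/-- The wrap-block direction is skew-Hermitian when `Y₀` is. [folklore] -/
theorem wrapBlockDir_conjTranspose (k : Fin 3) {Y₀ : Matrix (Fin 2) (Fin 2) ℂ} (hY₀ : Y₀ᴴ = -Y₀)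
    (w : (Fin (2 * L - 1 + 1) × Edge 3 L) ⊕ Site 3 L) : (wrapBlockDir (L := L) k Y₀ w)ᴴ = -wrapBlockDir (L := L) k Y₀ w := by
  rcases w with ie | x
  · simp only [wrapBlockDir, Sum.elim_inl]
    split_ifs
    · exact hY₀
    · rw [conjTranspose_zero, neg_zero]
  · simp only [wrapBlockDir, Sum.elim_inr, conjTranspose_zero, neg_zero]

omit [NeZero L] in
/-- The wrap-block direction is traceless when `Y₀` is. [folklore] -/
theorem wrapBlockDir_trace (k : Fin 3) {Y₀ : Matrix (Fin 2) (Fin 2) ℂ} (hY₀0 : Y₀.trace = 0)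
    (w : (Fin (2 * L - 1 + 1) × Edge 3 L) ⊕ Site 3 L) : (wrapBlockDir (L := L) k Y₀ w).trace = 0 := by
  rcases w with ie | x
  · simp only [wrapBlockDir, Sum.elim_inl]
    split_ifs
    · exact hY₀0
    · simp only [Matrix.trace_zero]
  · simp only [wrapBlockDir, Sum.elim_inr, trace_zero]

omit [NeZero L] in
/-- The seam-block direction is skew-Hermitian when `Y₀` is. [folklore] -/
theorem seamBlockDir_conjTranspose {Y₀ : Matrix (Fin 2) (Fin 2) ℂ} (hY₀ : Y₀ᴴ = -Y₀)
    (w : (Fin (2 * L - 1 + 1) × Edge 3 L) ⊕ Site 3 L) : (seamBlockDir (L := L) Y₀ w)ᴴ = -seamBlockDir (L := L) Y₀ w := by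
  rcases w with ie | x
  · simp only [seamBlockDir, Sum.elim_inl, conjTranspose_zero, neg_zero]
  · simpa only [seamBlockDir, Sum.elim_inr] using hY₀

omit [NeZero L] in
/-- The seam-block direction is traceless when `Y₀` is. [folklore] -/
theorem seamBlockDir_trace {Y₀ : Matrix (Fin 2) (Fin 2) ℂ} (hY₀0 : Y₀.trace = 0)
    (w : (Fin (2 * L - 1 + 1) × Edge 3 L) ⊕ Site 3 L) : (seamBlockDir (L := L) Y₀ w).trace = 0 := by
  rcases w with ie | x
  · simp only [seamBlockDir, Sum.elim_inl, trace_zero]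
  · simpa only [seamBlockDir, Sum.elim_inr] using hY₀0

/-- `expSU` depends only on the matrix (proof-irrelevant arguments). [folklore] -/
theorem expSU_congr {Y Y' : Matrix (Fin 2) (Fin 2) ℂ} (hY : Yᴴ = -Y) (hY0 : Y.trace = 0) (hY' : Y'ᴴ = -Y') (hY0' : Y'.trace = 0)
    (h : Y = Y') (s : ℝ) : expSU (N := 2) hY hY0 s = expSU (N := 2) hY' hY0' s := by
  subst h
  rfl

/-- `expSU` of the zero matrix is the identity at every time. [folklore] -/
theorem expSU_eq_one_of_eq_zero {Y : Matrix (Fin 2) (Fin 2) ℂ} (hY : Yᴴ = -Y) (hY0 : Y.trace = 0) (h : Y = 0) (s : ℝ) :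
    expSU (N := 2) hY hY0 s = 1 := by
  apply Subtype.ext
  rw [coe_expSU, h, smul_zero, NormedSpace.exp_zero]
  rfl

omit [NeZero L] in
/-- The multi-direction curve of the wrap-block direction: `exp(sY₀)` on the wrap links of direction `k`, `1` elsewhere. [folklore] -/
theorem multiCurve_wrapBlockDir (k : Fin 3) {Y₀ : Matrix (Fin 2) (Fin 2) ℂ} (hY₀ : Y₀ᴴ = -Y₀) (hY₀0 : Y₀.trace = 0) (s : ℝ) :
    multiCurve (wrapBlockDir (L := L) k Y₀) (wrapBlockDir_conjTranspose k hY₀) (wrapBlockDir_trace k hY₀0) s =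
      ((fun _ e => if e.1 e.2 = -1 ∧ e.2 = k then expSU (N := 2) hY₀ hY₀0 s else 1), fun _ => 1) := by
  unfold multiCurve
  refine Prod.ext ?_ ?_
  · funext i e
    dsimp only
    by_cases h : e.1 e.2 = -1 ∧ e.2 = k
    · rw [if_pos h]
      exact expSU_congr _ _ hY₀ hY₀0 (by simp only [wrapBlockDir, Sum.elim_inl, if_pos h]) s
    · rw [if_neg h]
      exact expSU_eq_one_of_eq_zero _ _ (by simp only [wrapBlockDir, Sum.elim_inl, if_neg h]) s
  · funext x
    dsimp only
    exact expSU_eq_one_of_eq_zero _ _ (by simp only [wrapBlockDir, Sum.elim_inr]) s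

omit [NeZero L] in
/-- The multi-direction curve of the seam-block direction: `exp(sY₀)` on every seam site, `1` on the slices. [folklore] -/
theorem multiCurve_seamBlockDir {Y₀ : Matrix (Fin 2) (Fin 2) ℂ} (hY₀ : Y₀ᴴ = -Y₀) (hY₀0 : Y₀.trace = 0) (s : ℝ) :
    multiCurve (seamBlockDir (L := L) Y₀) (seamBlockDir_conjTranspose hY₀) (seamBlockDir_trace hY₀0) s =
      ((fun _ _ => 1), fun _ => expSU (N := 2) hY₀ hY₀0 s) := by
  unfold multiCurve
  refine Prod.ext ?_ ?_
  · funext i e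
    dsimp only
    exact expSU_eq_one_of_eq_zero _ _ (by simp only [seamBlockDir, Sum.elim_inl]) s
  · funext x
    dsimp only
    exact expSU_congr _ _ hY₀ hY₀0 (by simp only [seamBlockDir, Sum.elim_inr]) s

omit [NeZero L] in
/-- Moving the comb point along the wrap-block curve multiplies the datum `h' k` by `u` on the right. [folklore] -/
theorem comb_mul_wrapBlock (h' : Fin 3 → SU2) (c' : SU2) (k : Fin 3) (u : SU2) :
    (((fun _ => combFlat h'), fun _ => c') : (Fin (2 * L - 1 + 1) → GaugeConfig 3 L SU2) × (Site 3 L → SU2)) *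
        ((fun _ e => if e.1 e.2 = -1 ∧ e.2 = k then u else 1), fun _ => 1) =
      ((fun _ => combFlat (Function.update h' k (h' k * u))), fun _ => c') := by
  refine Prod.ext ?_ ?_
  · funext i e
    simp only [Prod.fst_mul, Pi.mul_apply, combFlat_apply]
    by_cases h1 : e.1 e.2 = -1
    · rw [if_pos h1, if_pos h1]
      by_cases h2 : e.2 = k
      · rw [if_pos ⟨h1, h2⟩, h2, Function.update_self]
      · rw [if_neg (fun h => h2 h.2), Function.update_of_ne h2, mul_one]
    · rw [if_neg h1, if_neg h1, if_neg (fun h => h1 h.1), mul_one]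
  · funext x
    simp only [Prod.snd_mul, Pi.mul_apply, mul_one]

omit [NeZero L] in
/-- Moving the comb point along the seam-block curve multiplies the seam datum `c'` by `u` on the right. [folklore] -/
theorem comb_mul_seamBlock (h' : Fin 3 → SU2) (c' : SU2) (u : SU2) :
    (((fun _ => combFlat h'), fun _ => c') : (Fin (2 * L - 1 + 1) → GaugeConfig 3 L SU2) × (Site 3 L → SU2)) *
        ((fun _ _ => 1), fun _ => u) = ((fun _ => combFlat h'), fun _ => c' * u) := by
  refine Prod.ext ?_ ?_
  · funext i e
    simp only [Prod.fst_mul, Pi.mul_apply, mul_one]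
  · funext x
    simp only [Prod.snd_mul, Pi.mul_apply]

omit [NeZero L] in
/-- The comb ring with data `(h', c')` written with the trivial gauge field `t = 1` is the plain comb point. [folklore] -/
theorem combRing_one (h' : Fin 3 → SU2) (c' : SU2) :
    (((fun _ => gaugeTransform (1 : Site 3 L → SU2)⁻¹ (combFlat h')), fun x => ((1 : Site 3 L → SU2) x)⁻¹ * c' * (1 : Site 3 L → SU2) x) :
        (Fin (2 * L - 1 + 1) → GaugeConfig 3 L SU2) × (Site 3 L → SU2)) = ((fun _ => combFlat h'), fun _ => c') := by
  refine Prod.ext ?_ ?_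
  · funext i
    dsimp only
    rw [inv_one]
    funext e
    simp [gaugeTransform]
  · funext x
    simp only [Pi.one_apply, inv_one, one_mul, mul_one]

/-- ★ **The wrap-block curves through a comb point with commuting data are flat** whenever the moving factor `exp(sY₀)` centralises the
data. [cite: Luscher1983, §2] -/
theorem ringDeficit_comb_mul_multiCurve_wrapBlockDir_eq_zero {h' : Fin 3 → SU2} {c' : SU2}
    (hh'c : ∀ i j, h' i * h' j = h' j * h' i) (hc'h : ∀ k, c' * h' k = h' k * c') (k : Fin 3)
    {Y₀ : Matrix (Fin 2) (Fin 2) ℂ} (hY₀ : Y₀ᴴ = -Y₀) (hY₀0 : Y₀.trace = 0)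
    (huh : ∀ s j, expSU (N := 2) hY₀ hY₀0 s * h' j = h' j * expSU (N := 2) hY₀ hY₀0 s)
    (huc : ∀ s, expSU (N := 2) hY₀ hY₀0 s * c' = c' * expSU (N := 2) hY₀ hY₀0 s) (s : ℝ) :
    ringDeficit L (fun _ => false)
      ((((fun _ => combFlat h'), fun _ => c') : (Fin (2 * L - 1 + 1) → GaugeConfig 3 L SU2) × (Site 3 L → SU2)) *
        multiCurve (wrapBlockDir (L := L) k Y₀) (wrapBlockDir_conjTranspose k hY₀) (wrapBlockDir_trace k hY₀0) s) = 0 := by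
  rw [multiCurve_wrapBlockDir, comb_mul_wrapBlock, ← combRing_one]
  exact ringDeficit_combRing_update_eq_zero 1 hh'c hc'h (huh s) (huc s) k

/-- ★ **The seam-block curve through a comb point with commuting data is flat** whenever `exp(sY₀)` centralises the wrap data.
[cite: Luscher1983, §2] -/
theorem ringDeficit_comb_mul_multiCurve_seamBlockDir_eq_zero {h' : Fin 3 → SU2} {c' : SU2}
    (hh'c : ∀ i j, h' i * h' j = h' j * h' i) (hc'h : ∀ k, c' * h' k = h' k * c')
    {Y₀ : Matrix (Fin 2) (Fin 2) ℂ} (hY₀ : Y₀ᴴ = -Y₀) (hY₀0 : Y₀.trace = 0)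
    (huh : ∀ s j, expSU (N := 2) hY₀ hY₀0 s * h' j = h' j * expSU (N := 2) hY₀ hY₀0 s) (s : ℝ) :
    ringDeficit L (fun _ => false)
      ((((fun _ => combFlat h'), fun _ => c') : (Fin (2 * L - 1 + 1) → GaugeConfig 3 L SU2) × (Site 3 L → SU2)) *
        multiCurve (seamBlockDir (L := L) Y₀) (seamBlockDir_conjTranspose hY₀) (seamBlockDir_trace hY₀0) s) = 0 := by
  rw [multiCurve_seamBlockDir, comb_mul_seamBlock]
  have h := ringDeficit_combRing_seam_mul_eq_zero (L := L) (1 : Site 3 L → SU2) (u := expSU (N := 2) hY₀ hY₀0 s) hh'c hc'h (huh s)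
  have e : (((fun _ => gaugeTransform (1 : Site 3 L → SU2)⁻¹ (combFlat h')),
      fun x => ((1 : Site 3 L → SU2) x)⁻¹ * (c' * expSU (N := 2) hY₀ hY₀0 s) * (1 : Site 3 L → SU2) x) :
        (Fin (2 * L - 1 + 1) → GaugeConfig 3 L SU2) × (Site 3 L → SU2)) = ((fun _ => combFlat h'), fun _ => c' * expSU (N := 2) hY₀ hY₀0 s) :=
    combRing_one h' _
  rw [e] at h
  exact h

/-! ## §3 On an axis: the sheet generator centralises the axis family -/

/-- ★ The one-parameter group of `quatMatrix ⟨0,n₁,n₂,n₃⟩` commutes with every `y ∈ SU(2)` whose quaternion has imaginary part parallel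
to `(n₁,n₂,n₃)`. [folklore] -/
theorem expSU_quatMatrix_comm_of_im_parallel (n₁ n₂ n₃ : ℝ) {y : SU2} {t : ℝ}
    (hy : (su2Quat y).imI = t * n₁ ∧ (su2Quat y).imJ = t * n₂ ∧ (su2Quat y).imK = t * n₃) (s : ℝ) :
    expSU (N := 2) (quatMatrix_im_conjTranspose n₁ n₂ n₃) (quatMatrix_im_trace n₁ n₂ n₃) s * y =
      y * expSU (N := 2) (quatMatrix_im_conjTranspose n₁ n₂ n₃) (quatMatrix_im_trace n₁ n₂ n₃) s := by
  apply Subtype.ext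
  rw [Submonoid.coe_mul, Submonoid.coe_mul, coe_expSU, ← quatMatrix_su2Quat y]
  have hp : (⟨0, n₁, n₂, n₃⟩ : ℍ).imI = 1 * n₁ ∧ (⟨0, n₁, n₂, n₃⟩ : ℍ).imJ = 1 * n₂ ∧ (⟨0, n₁, n₂, n₃⟩ : ℍ).imK = 1 * n₃ := by
    refine ⟨?_, ?_, ?_⟩ <;> simp
  have hcomm : Commute (quatMatrix (⟨0, n₁, n₂, n₃⟩ : ℍ)) (quatMatrix (su2Quat y)) := by
    rw [Commute, SemiconjBy, ← quatMatrix_mul, ← quatMatrix_mul, mul_comm_of_im_parallel' hy hp]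
  exact ((hcomm.smul_left s).exp_left).eq

/-- Two elements of `SU(2)` whose quaternions have imaginary parts parallel to one axis commute. [folklore] -/
theorem comm_of_im_parallel {n₁ n₂ n₃ : ℝ} {x y : SU2} {σ t : ℝ}
    (hx : (su2Quat x).imI = σ * n₁ ∧ (su2Quat x).imJ = σ * n₂ ∧ (su2Quat x).imK = σ * n₃)
    (hy : (su2Quat y).imI = t * n₁ ∧ (su2Quat y).imJ = t * n₂ ∧ (su2Quat y).imK = t * n₃) : x * y = y * x := by
  apply Subtype.ext
  rw [Submonoid.coe_mul, Submonoid.coe_mul, ← quatMatrix_su2Quat x, ← quatMatrix_su2Quat y, ← quatMatrix_mul, ← quatMatrix_mul,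
    mul_comm_of_im_parallel' hy hx]

/-- ★★ **The three wrap sheet curves at a comb ring ON AN AXIS are flat.**  Comb data `h' : Fin 3 → SU2`, `c' : SU2` with quaternions on the
axis `n` (the output shape of ✓`exists_commuting_near_of_far_axis`): turning `h' k` along `exp(s·quatMatrix⟨0,n⟩)` keeps `F₀ = 0`.
[cite: Luscher1983, §2] -/
theorem ringDeficit_comb_wrapSheet_eq_zero (n₁ n₂ n₃ : ℝ) {h' : Fin 3 → SU2} {c' : SU2} {th : Fin 3 → ℝ} {tc : ℝ}
    (hh' : ∀ j, (su2Quat (h' j)).imI = th j * n₁ ∧ (su2Quat (h' j)).imJ = th j * n₂ ∧ (su2Quat (h' j)).imK = th j * n₃)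
    (hc' : (su2Quat c').imI = tc * n₁ ∧ (su2Quat c').imJ = tc * n₂ ∧ (su2Quat c').imK = tc * n₃) (k : Fin 3) (s : ℝ) :
    ringDeficit L (fun _ => false)
      ((((fun _ => combFlat h'), fun _ => c') : (Fin (2 * L - 1 + 1) → GaugeConfig 3 L SU2) × (Site 3 L → SU2)) *
        multiCurve (wrapBlockDir (L := L) k (quatMatrix (⟨0, n₁, n₂, n₃⟩ : ℍ))) (wrapBlockDir_conjTranspose k (quatMatrix_im_conjTranspose n₁ n₂ n₃))
          (wrapBlockDir_trace k (quatMatrix_im_trace n₁ n₂ n₃)) s) = 0 := by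
  have hh'c : ∀ i j, h' i * h' j = h' j * h' i := fun i j => comm_of_im_parallel (hh' i) (hh' j)
  have hc'h : ∀ k, c' * h' k = h' k * c' := fun k => comm_of_im_parallel hc' (hh' k)
  exact ringDeficit_comb_mul_multiCurve_wrapBlockDir_eq_zero hh'c hc'h k _ _
    (fun s j => expSU_quatMatrix_comm_of_im_parallel n₁ n₂ n₃ (hh' j) s) (fun s => expSU_quatMatrix_comm_of_im_parallel n₁ n₂ n₃ hc' s) s

/-- ★★ **The seam sheet curve at a comb ring ON AN AXIS is flat**: turning `c'` along `exp(s·quatMatrix⟨0,n⟩)` keeps `F₀ = 0`.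
[cite: Luscher1983, §2] -/
theorem ringDeficit_comb_seamSheet_eq_zero (n₁ n₂ n₃ : ℝ) {h' : Fin 3 → SU2} {c' : SU2} {th : Fin 3 → ℝ} {tc : ℝ}
    (hh' : ∀ j, (su2Quat (h' j)).imI = th j * n₁ ∧ (su2Quat (h' j)).imJ = th j * n₂ ∧ (su2Quat (h' j)).imK = th j * n₃)
    (hc' : (su2Quat c').imI = tc * n₁ ∧ (su2Quat c').imJ = tc * n₂ ∧ (su2Quat c').imK = tc * n₃) (s : ℝ) :
    ringDeficit L (fun _ => false)
      ((((fun _ => combFlat h'), fun _ => c') : (Fin (2 * L - 1 + 1) → GaugeConfig 3 L SU2) × (Site 3 L → SU2)) *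
        multiCurve (seamBlockDir (L := L) (quatMatrix (⟨0, n₁, n₂, n₃⟩ : ℍ))) (seamBlockDir_conjTranspose (quatMatrix_im_conjTranspose n₁ n₂ n₃))
          (seamBlockDir_trace (quatMatrix_im_trace n₁ n₂ n₃)) s) = 0 := by
  have hh'c : ∀ i j, h' i * h' j = h' j * h' i := fun i j => comm_of_im_parallel (hh' i) (hh' j)
  have hc'h : ∀ k, c' * h' k = h' k * c' := fun k => comm_of_im_parallel hc' (hh' k)
  exact ringDeficit_comb_mul_multiCurve_seamBlockDir_eq_zero hh'c hc'h _ _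
    (fun s j => expSU_quatMatrix_comm_of_im_parallel n₁ n₂ n₃ (hh' j) s) s

/-! ## §4 The four sheet tangents are exact kernel vectors of the frame Hessian at the comb ring -/

/-- ★★★ **WRAP SHEET TANGENTS ARE EXACT KERNEL VECTORS.**  At the comb ring `p = ((fun _ => combFlat h'), fun _ => c')` with data on the axis
`n`, for EVERY skew-Hermitian traceless frame family `τ` and every coordinate vector `κ` whose direction is the wrap-block direction
`dirOf τ κ = wrapBlockDir k (quatMatrix⟨0,n⟩)`: `Ĥ(p)κ = 0`. [cite: Luscher1983, §2] -/
theorem frameHessRaw_mulVec_eq_zero_of_dirOf_eq_wrapBlockDir [Fintype ι]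
    (τ : ι → ((Fin (2 * L - 1 + 1) × Edge 3 L) ⊕ Site 3 L) → Matrix (Fin 2) (Fin 2) ℂ) (hτ : ∀ j w, (τ j w)ᴴ = -τ j w) (hτ0 : ∀ j w, (τ j w).trace = 0)
    (n₁ n₂ n₃ : ℝ) {h' : Fin 3 → SU2} {c' : SU2} {th : Fin 3 → ℝ} {tc : ℝ}
    (hh' : ∀ j, (su2Quat (h' j)).imI = th j * n₁ ∧ (su2Quat (h' j)).imJ = th j * n₂ ∧ (su2Quat (h' j)).imK = th j * n₃)
    (hc' : (su2Quat c').imI = tc * n₁ ∧ (su2Quat c').imJ = tc * n₂ ∧ (su2Quat c').imK = tc * n₃) (k : Fin 3)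
    {κ : ι → ℝ} (hκ : dirOf τ κ = wrapBlockDir (L := L) k (quatMatrix (⟨0, n₁, n₂, n₃⟩ : ℍ))) :
    frameHessRaw (L := L) τ (ringCoord L (((fun _ => combFlat h'), fun _ => c') : (Fin (2 * L - 1 + 1) → GaugeConfig 3 L SU2) × (Site 3 L → SU2))) *ᵥ κ = 0 := by
  refine frameHessRaw_mulVec_eq_zero_of_flat τ hτ hτ0 κ fun s => ?_
  rw [multiCurve_congr _ _ (wrapBlockDir_conjTranspose k (quatMatrix_im_conjTranspose n₁ n₂ n₃))
    (wrapBlockDir_trace k (quatMatrix_im_trace n₁ n₂ n₃)) hκ s]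
  exact ringDeficit_comb_wrapSheet_eq_zero n₁ n₂ n₃ hh' hc' k s

/-- ★★★ **THE SEAM SHEET TANGENT IS AN EXACT KERNEL VECTOR**: same, with `dirOf τ κ = seamBlockDir (quatMatrix⟨0,n⟩)`. [cite: Luscher1983, §2] -/
theorem frameHessRaw_mulVec_eq_zero_of_dirOf_eq_seamBlockDir [Fintype ι]
    (τ : ι → ((Fin (2 * L - 1 + 1) × Edge 3 L) ⊕ Site 3 L) → Matrix (Fin 2) (Fin 2) ℂ) (hτ : ∀ j w, (τ j w)ᴴ = -τ j w) (hτ0 : ∀ j w, (τ j w).trace = 0)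
    (n₁ n₂ n₃ : ℝ) {h' : Fin 3 → SU2} {c' : SU2} {th : Fin 3 → ℝ} {tc : ℝ}
    (hh' : ∀ j, (su2Quat (h' j)).imI = th j * n₁ ∧ (su2Quat (h' j)).imJ = th j * n₂ ∧ (su2Quat (h' j)).imK = th j * n₃)
    (hc' : (su2Quat c').imI = tc * n₁ ∧ (su2Quat c').imJ = tc * n₂ ∧ (su2Quat c').imK = tc * n₃)
    {κ : ι → ℝ} (hκ : dirOf τ κ = seamBlockDir (L := L) (quatMatrix (⟨0, n₁, n₂, n₃⟩ : ℍ))) :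
    frameHessRaw (L := L) τ (ringCoord L (((fun _ => combFlat h'), fun _ => c') : (Fin (2 * L - 1 + 1) → GaugeConfig 3 L SU2) × (Site 3 L → SU2))) *ᵥ κ = 0 := by
  refine frameHessRaw_mulVec_eq_zero_of_flat τ hτ hτ0 κ fun s => ?_
  rw [multiCurve_congr _ _ (seamBlockDir_conjTranspose (quatMatrix_im_conjTranspose n₁ n₂ n₃))
    (seamBlockDir_trace (quatMatrix_im_trace n₁ n₂ n₃)) hκ s]
  exact ringDeficit_comb_seamSheet_eq_zero n₁ n₂ n₃ hh' hc' s

/-! ## §5 The comb point seen on the tree-gauged space `X_fix` -/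

omit [NeZero L] in
/-- `glue` of the off-tree part of a comb-flat configuration is the configuration itself (its tree links are `1`). [folklore] -/
theorem glue_off_combFlat (h' : Fin 3 → SU2) : glue (fun e : OffIdx L => combFlat h' e.1) = combFlat h' := by
  funext e
  by_cases he : treeEdge e = true
  · rw [glue_apply_of_tree _ he, combFlat_apply]
    rw [treeEdge_iff] at he
    have hne : e.1 e.2 ≠ -1 := by
      rcases he with ⟨h2, h⟩ | ⟨h2, -, h⟩ | ⟨h2, -, -, h⟩ <;> rwa [h2]
    rw [if_neg hne]
  · rw [glue_apply_of_not_tree _ he]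

omit [NeZero L] in
/-- ★ The tree-gauge embedding `x ↦ (glue x.1 ∷ x.2.1, x.2.2)` of ✓`TreeGaugeTransfer.gibbsMean_eq_fix` sends the comb point of `X_fix`
(off-tree part of `combFlat h'`, every later slice `combFlat h'`, constant seam `c'`) to the comb point of `Ω_L`. [folklore] -/
theorem fixEmbed_fixComb (h' : Fin 3 → SU2) (c' : SU2) :
    ((Fin.cons (glue (fun e : OffIdx L => combFlat h' e.1)) (fun _ : Fin (2 * L - 1) => (combFlat h' : GaugeConfig 3 L SU2)),
        (fun _ : Site 3 L => c')) : (Fin (2 * L - 1 + 1) → GaugeConfig 3 L SU2) × (Site 3 L → SU2)) =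
      ((fun _ => combFlat h'), fun _ => c') := by
  rw [glue_off_combFlat]
  exact Prod.ext (Fin.cons_self_tail (fun _ : Fin (2 * L - 1 + 1) => (combFlat h' : GaugeConfig 3 L SU2))) rfl

end Summit.QuantumFields.YangMills.Theorems.VirialFluxGap.RegularValley

end
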